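import Summits.QuantumFields.YangMills.Theorems.SwapVirialDeficitSectorLaplaceBTubeFibredScaled
import HarnessLib

/-!
# N2a step (v) — the CRUDE one-loop weight off the localisation radius: `(√det A)⁻¹ ≤ (√(λ^d))⁻¹` from `λ`-coercivity
# (stub `stub_end_gaussCore`, NEAR₂ term of memo11c (2)/memo-N2a(iv): with T1's `(μ_F/2)`-coercivity at the minimiser (✓`endGauss_N2_near_raw`, 2nd conjunct) the follower
# determinant factor is `≤ (μ_F/2)^{−d/2}` — `e^{O(d log L)}`, to be killed by `e^{−(5b/6)m}` with the NEAR₂ floor; free-hands support of ⟨stmt-QuantumFields-24197⟩)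

* ★ `sqrt_det_inv_le_of_coercive` — symmetric `A` on a finite-dimensional inner product space, `λ‖y‖² ≤ ⟪Ay,y⟫` (`λ > 0`) ⟹ `(√det A)⁻¹ ≤ (√(λ^{finrank}))⁻¹`
  (✓`det_ge_pow_of_coercive`); `ofReal` form `ofReal_sqrt_det_inv_le_of_coercive`.

HONEST LABEL: one-line consequence of a landed lemma; the N2 glue (`endGauss_N2` into g49's socket) and the plug of `stub_end_gaussCore`, and `stub_core_tip`, are OPEN ⟹
⟨24197⟩ ∕ ⟨24194⟩ OPEN; own crux ⟨22884⟩ OPEN (blocked-on ⟨19935⟩); the Yang–Mills mass gap is NOT proved; no summit is proved by a line.  THEOREMS ONLY (0 `def`, 0 `sorry`),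
standard axioms.  Width seat ym-line-sfw-p2-w3 g67 (cell ym-idea-1, free hands), `--supports stmt-QuantumFields-24197`.  References: [folklore].
-/

set_option autoImplicit false

noncomputable section

open MeasureTheory Module
open scoped ENNReal InnerProductSpace

namespace Summit.QuantumFields.YangMills.Theorems.SwapVirialDeficit.SectorLaplace

open Summit.QuantumFields.YangMills.Theorems.SwapVirialDeficit.BlowUpRing

/-- ★ `(√det A)⁻¹ ≤ (√(λ^{finrank}))⁻¹` for a `λ`-coercive symmetric operator. [folklore] -/
theorem sqrt_det_inv_le_of_coercive {V : Type*} [NormedAddCommGroup V] [InnerProductSpace ℝ V] [FiniteDimensional ℝ V] [MeasurableSpace V] [BorelSpace V]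
    {A : V →ₗ[ℝ] V} (hA : A.IsSymmetric) {lam : ℝ} (hlam : 0 < lam) (hcoer : ∀ y : V, lam * ‖y‖ ^ 2 ≤ ⟪A y, y⟫_ℝ) :
    (Real.sqrt (LinearMap.det A))⁻¹ ≤ (Real.sqrt (lam ^ finrank ℝ V))⁻¹ := by
  have hdet := det_ge_pow_of_coercive hA hlam hcoer
  have hpos : 0 < Real.sqrt (lam ^ finrank ℝ V) := Real.sqrt_pos.2 (by positivity)
  exact inv_anti₀ hpos (Real.sqrt_le_sqrt hdet)

/-- The same in `ℝ≥0∞`. [folklore] -/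
theorem ofReal_sqrt_det_inv_le_of_coercive {V : Type*} [NormedAddCommGroup V] [InnerProductSpace ℝ V] [FiniteDimensional ℝ V] [MeasurableSpace V] [BorelSpace V]
    {A : V →ₗ[ℝ] V} (hA : A.IsSymmetric) {lam : ℝ} (hlam : 0 < lam) (hcoer : ∀ y : V, lam * ‖y‖ ^ 2 ≤ ⟪A y, y⟫_ℝ) :
    ENNReal.ofReal ((Real.sqrt (LinearMap.det A))⁻¹) ≤ ENNReal.ofReal ((Real.sqrt (lam ^ finrank ℝ V))⁻¹) :=
  ENNReal.ofReal_le_ofReal (sqrt_det_inv_le_of_coercive hA hlam hcoer)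

end Summit.QuantumFields.YangMills.Theorems.SwapVirialDeficit.SectorLaplace

end
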